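import Summits.QuantumAdvantage.QuantumAdvantage.Theorems.ShadowDialC
import HarnessLib

/-! # PhaseDialA — part 1/6 of the landing twins of NODE «PhaseDial» (decomp-qadv lens-2 g25; node file
`g25/PhaseDial.lean`, sha256 bb3dee64cd7f1b2c…; generator `g25/tree/gen_twins.py`: namespace `Theses.PhaseDial` →
`Theorems.PhaseDial`, cut at section boundaries (node lines 130–306), nothing else).
Content: §1 the DIAL (`aphase`, `PhaseForm`, `StabPhase`; the pieces `PhaseLoss3` (special), `NonPhaseLoss3` (residual, gen 3)) and §2 the NODE: `closes : PhaseLoss3 → NonPhaseLoss3 → AbelianDial.NonAbelianLoss3` BY NAME, `closesB` (→ 27009), `closesD` (→ 27656), `phase_of_G` / `nonPhase_of_G` (both pieces G-implied), `split_iff` / `splitB_iff` / `splitT_iff` (exactness), saturation (`stabPhase_of_stabTable`, `aphase_one`). -/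

/-!
# PhaseDial — decomp-qadv lens-2 (structural dichotomy: special vs generic), generation 25

TARGET (by name): `G := Summit.QuantumAdvantage.QuantumAdvantage.Theorems.AbelianDial.NonAbelianLoss3` — the RESIDUAL
(gen 2) of the g23 node «AbelianDial» beneath item B = stmt-QuantumAdvantage-27009
`Theses.SparsityDial.NonCounterGenericLoss3` (`Theorems.AbelianDial.split_iff : B ↔ AbelianLoss3 ∧ G`) and item D =
stmt-27656 `DenseGenericLoss3` (`Theorems.AbelianDial.closesD`, with `CounterLoss3` = stmt-27008); by g24
(`Theorems.ShadowDial.residual_iff`) `G ↔ TernaryLoss3`, g24's re-typed residual.  G says: for SOME abelian type `(M, R)`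
and exponents `a, C`, every `𝔽₃`-degree-`(log₂ n)^c` strategy of the cyclic ring game (`RingHLF.Rel`, canonical guess
`tGuess`) that is DENSE (`¬ StabFew`), NOT cheaply counter-form and NOT cheaply `(M, R)`-table-form wins at most
`(1 − n^{−C})·2^{n−1}` odd inputs.  Nothing here proves 27009 / 27656 or the summit: rung 0, cell currency.

THE DIAL (special vs generic).  g23 cut G's parent by the ABELIAN type of the deviation gates (`G_k(Σ_i v_{k,i} x_i)` over
`(Z_{M+1})^R`, a program over a bounded abelian group), g24 by the CHARACTERISTIC of the output map.  This node dials the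
NILPOTENCY CLASS = POLYNOMIAL-PHASE DEGREE: SPECIAL := after a cheap stabilizer gauge (`pad`, the lineage's format) every
deviation gate factors as `G_k ∘ aphase` through `r` POLYNOMIAL PHASES OF DEGREE `≤ d` OVER `Z_{m+1}`,
`aphase m r d w x j = Σ_{τ : d-tuples of cells} w_{τ,j}·Π_s x_{τ s}` (`PhaseForm`, `StabPhase m r d e`), the TYPE `(m, r, d)`
BOUNDED — in circuit words `G ∘ (r gates MOD_{m+1} ∘ AND_d)` per output, the bottom-fan-in-`d` class of the
Constant-Degree Hypothesis; in the Barrington–Straubing–Thérien dictionary, programs over class-`d` nilpotent groups of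
bounded exponent.  Degree `d = 1` IS g23's abelian dial (`aphase_one`, `stabPhase_one_iff`): the phase dial EXTENDS it.
GENERIC := of no bounded phase type under any cheap gauge.

NODE: `G ⟸ PhaseLoss3 ∧ NonPhaseLoss3` (`closes` BY NAME; `closesB` → 27009 with `AbelianLoss3`; `closesD` → 27656 with
`CounterLoss3`, `AbelianLoss3`), EXACT (`split_iff : G ↔ S ∧ R`; `splitB_iff : B ↔ AbelianLoss3 ∧ S ∧ R`; `splitT_iff :
TernaryLoss3 ↔ S ∧ R`), BOTH pieces G-implied (`phase_of_G`, `nonPhase_of_G`) and NEITHER gives G alone (bc/Probe F5, F6):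
NOT a law node — the residual is NOT `↔ G`.
* `PhaseLoss3` (S, SPECIAL) — `∀ (m, r, d) ∃ (M, R, a, C)`: dense ∧ ¬cheap-counter ∧ ¬cheap-`(M,R)`-table ∧
  cheap-`(m,r,d)`-PHASE ⟹ loss `n^{−C}`.  **WEAKER** (G ⟹ S `phase_of_G`; S ⊬ G F5) · = a conjunction of CELLS
  `PhaseCell m r d` (`phaseLoss3_iff`) with this CELL MAP:
  – TRIVIAL cells (honest, no content): `d = 0`, modulus `1`, `d = 1` (a phase form that is already a table form is
    excluded by the `¬ StabTable` hypothesis at the same type: `phaseCell_deg_zero / _mod_one / _deg_one`);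
  – ★ **DECIDED cells — the 2-PRIMARY LAYER, a THEOREM** (`phase_twoPow_holds`, `phaseCell_twoPow`, §6–§7): for EVERY
    modulus `2^k`, every rank `r`, every degree `d`, cheaply-`(2^k − 1, r, d)`-phase-form strategies lose a polynomial
    fraction (`C = 1`), none of G's other hypotheses used.  ENGINE: LUCAS (`Literature…natCast_choose_pow_sub_one`,
    `C(z, 2^k − 1) ≡ [z ≡ −1 (2^k)]`) + VANDERMONDE along the monomials (`choose_sum_mem`: `x ↦ C(Σ_τ a_τ x^τ + s, L)`
    has degree `≤ L·d` over any field) ⟹ every value indicator of a degree-`d` phase mod `2^k` is an `𝔽₂`-polynomial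
    of degree `≤ (2^k − 1)d` (`modInd_sum_mem`, `phase_val_ind_mem`), a table of `r` of them has degree `≤ r(2^k − 1)d`
    (Möbius over `(Z_{2^k})^r`, `table_mem_lowDeg'`), so every output bit of the gauged strategy AGREES ON THE ODD CLASS
    with an `𝔽₂`-polynomial of degree `≤ r(2^k − 1)d + 1` (`fg`, `fg_twoPow_mem`, `fg_agree`) playing the same game on
    the same odd inputs (`StabilizerDial.winset_pad`): the tree's characteristic-2 law `AdviceFreeQNC0.ringHardOdd_two`
    bounds the wins.  (The engine decides the whole class «every output bit is polylog-`𝔽₂`-degree ON THE ODD CLASS after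
    a cheap gauge», which contains g24's F-class; phase form constrains odd inputs only, so `StabPhase ⊄ StabF2`.)
  – ★ **ODD PRIME-POWER cells REDUCE to constant-degree single-characteristic RUNGS** (§8, the engine typed for every
    prime): `PhaseCell (p^k − 1) r d ⟸ RingDegLoss p (r(p^k − 1)d + 2)` (`phaseCell_primePow_of_ringDegLoss`), where
    `RingDegLoss p D` := «output polynomials of `𝔽_p`-degree `≤ D` ⟹ loss `n^{−C}` on the odd class» is a rung strictly
    below the polylog constant-fraction crux `RingHardOdd p` (`ringDegLoss_of_ringHardOdd`; `ringDegLoss_two` is a theorem).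
    FIRST OPEN CELL `(2, 1, 2)` — ONE QUADRATIC PHASE MOD 3 — needs exactly `RingDegLoss 3 6` (`phaseCell_212_of_ringDegLoss`)
    and is INHABITED WITH CERTIFICATE by g23's matching family `qStrat` (`[Σ_t x_{p_t} x_{q_k(t)} ≡ 0 (3)]`): `q_phaseForm`,
    `q_stabPhase : StabPhase 2 1 2 e qStrat`, `q_special_certificate` (dense ∧ ¬counter ∧ ¬`(M,R)`-table for every type (g23)
    ∧ `(2,1,2)`-phase).  So the certified generic inhabitant of BOTH previous residuals (g23's G; g24's `TernaryLoss3`, whose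
    shadow has LINEAR `𝔽₂`-degree) MOVES TO THE SPECIAL SIDE: the dial is orthogonal to g23's and g24's.  At `p = 3` the
    tree's floor is AFFINE bells (`AffBells37.affBellsPolyLoss3`, whose docstring names «bells of degree ≥ 2» as untouched):
    OPEN · IDEA-NEEDED with a typed first statement.
  – the FRONTIER cells: `d ≥ 2` and a modulus that is NOT A PRIME POWER — two coprime moduli inside one gate, the genuinely
    Constant-Degree-Hypothesis cells (`Literature.Barriers.QuantumAdvantage.TwoModuliDepthTwo` records `d = 1` as a theorem
    and `d ≥ 2` as OPEN in print): OPEN · BARRIER-adjacent.  ★ THE FRONTIER IS EXACT (§9): cells are ANTITONE under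
    divisibility of the modulus (`Z_{m+1} ↪ Z_{t(m+1)}`, `a ↦ ta`: `stabPhase_dvd_mono`, `phaseCell_antitone`), so
    `phaseLoss3_iff_nonPrimePow_cells : S ↔ ⋀ {cells with d ≥ 2, modulus ≥ 3 not a prime power}` — S IS the conjunction of
    its two-coprime-moduli cells, and the prime-power cells are its weaker single-characteristic SUB-RUNGS
    (`primePow_cells_of_rungs`; also `phaseLoss3_iff_open_cells' : S ↔ ⋀ {cells with d ≥ 2, modulus not a 2-power}`).
* `NonPhaseLoss3` (R, GENERIC = the RESIDUAL, gen 3) — `∃ (m, r, d, a, C)`: dense ∧ ¬cheap-counter ∧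
  ¬cheap-`(m,r,d)`-PHASE ⟹ loss.  **WEAKER** (G ⟹ R with `d := 1`: `nonPhase_of_G` via `stabPhase_one_iff`; R ⊬ G: F6 —
  R at a type whose cell is open does not return G) · OPEN · IDEA-NEEDED.  Its hypothesis class is STRICTLY SMALLER than
  G's: beyond abelian tables it drops every bounded-type polynomial-phase family over every modulus (`qStrat` and all
  bounded-rank quadratic / cubic / … phase strategies, the `SYM ∘ AND_d`-readers of bounded type, …).  INHABITANT WITH
  CERTIFICATE (§4–§5): the hybrid `mqStrat` = g24's MULTIPLEXER at positions `< N − 1` ⊕ the quadratic matching gate at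
  the last position — `mq_generic_certificate`: dense (`𝔽₃`-degree `(log₂ N)^c`, `¬ StabFew`) and AT THE ZERO GAUGE not
  phase-form OF ANY BOUNDED TYPE (`mq_not_phaseForm_zero`, from the ★ COUNTING CERTIFICATE `mux_gate_not_phaseForm`: a
  phase-form gate is determined by `((m+1)^r)^{(aL N + 1)^d}·…` coefficient/table data on the address cells while the
  multiplexer realises `2^{2^{aL N}}` distinct address sub-functions — `yin` / `decode` / `cof_injective` / `card_bound` vs
  `count_lt`; all types `(m, r, d)` at once), not table-form of any type, not counter-form, and NOT `𝔽₂`-low of any polylog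
  degree (its last shadow is `qStrat`'s: LINEAR `𝔽₂`-degree, g24 `q_shadow_degree_linear`) — outside every law landed in
  the lineage (honest scope: the zero gauge, F16).

WHY EACH PIECE IS STRICTLY WEAKER.  S: implied by G (restrict to the phase class at G's own abelian type) and S ⊬ G (F5);
its content is a lattice of bounded-type cells of which a whole layer is now a theorem and the odd prime-power layer is a
family of constant-degree rungs.  R: implied by G (`d = 1`) and R ⊬ G (F6); its class omits the inhabited phase classes.
Neither piece nor both reach the summit (F7).  WHY THIS IS NOVEL.  No node of the cell dials the NILPOTENCY CLASS / PHASE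
DEGREE OVER ALL MODULI on the `p = 3` loss residual: g23 = class 1, g24 = characteristic of the output map, lens-5
«DegreeDial»/«LevelDial» = `𝔽_p`-degree / level of the strategy, lens-4 g27 «InnerDegreeDial» (posted the same hour, on the
PERFECT-strategy item 28487, `p ≥ 5`) dials the inner degree of `≤ log₂ n + 1` linear forms + ONE quadratic MOD `p` with the
modulus EQUAL to the game prime and decides its quadratic rung by restriction-linearisation; here the modulus `m + 1` is a
free parameter INDEPENDENT of the strategy's characteristic 3, `r` is bounded, `d` arbitrary, and the decided layer is the
2-PRIMARY one, by a Lucas/Vandermonde degree transfer to characteristic 2.  New mathematics: (a) the COUNTING CERTIFICATE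
`mux_gate_not_phaseForm`; (b) the kernel LUCAS ENGINE `choose_sum_mem` / `modInd_sum_mem` / `phase_val_ind_mem` /
`table_mem_lowDeg'` for every prime; (c) the 2-primary loss law `phase_twoPow_holds`; (d) the typed rung `RingDegLoss` with
`phaseCell_primePow_of_ringDegLoss`; (e) the modulus-divisibility monotonicity `stabPhase_dvd_mono` and the exact frontier
`phaseLoss3_iff_nonPrimePow_cells`.  BARRIERS: `TwoModuliDepthTwo` (BST90 / Krause–Pudlák / Grolmusz–Tardos; CDH): the
decided layer is its same-characteristic (p-group) side, the frontier cells its open `d ≥ 2` side — placed, not beaten;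
`NonclassicalDegreeLogBarrier` (Bhowmick–Lovett): the phases here have CONSTANT degree and the transfer uses exact
degree, no derivative/Gowers estimate — outside its class; it bites only the polylog crux `RingHardOdd 3` above the rungs.

Imports the tree only (`Theorems.ShadowDialC` = g24 landed parts A–C, which import g23 `AbelianDialC`;
`Literature.Combinatorics.Additive.TricoloredSumFreeBound` for Lucas).  0 `sorry`; axioms of the headline declarations =
`[propext, Classical.choice, Quot.sound]`.  Memo: `g25/NODE-g25.md`; probes: `g25/bc/`.
-/

set_option linter.dupNamespace false
noncomputable section
open scoped Classical

namespace Summit.QuantumAdvantage.QuantumAdvantage.Theorems.PhaseDial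
open Finset
open Literature.Computability.QuantumComplexity Literature.Computability.QuantumComplexity.RingHLF
open Literature.Computability.MetaComplexity Literature.Computability.MetaComplexity.Smolensky
open Summit.QuantumAdvantage.AdviceFreeQNC0
open Summit.QuantumAdvantage.QuantumAdvantage.Theorems.AnchorDial (outB dev loss_shape_mono)
open Summit.QuantumAdvantage.QuantumAdvantage.Theorems.StabilizerDial (apIdx apStrat apStrat_mem apStrat_apply pad
  pad_mem StabFew outB_pad_pad outB_pad_congr bitP_gsum gsum gsum_mem deg_gsum dev_congr eventually_polylog winset_pad)
open Summit.QuantumAdvantage.QuantumAdvantage.Theorems.SparsityDial (real_loss_of_frac stabFew_mono_mr one_le_logpow)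
open Summit.QuantumAdvantage.QuantumAdvantage.Theorems.ResponseDial (mem_dev_apStrat dev_pad_zero
  not_polylogSparse_of_agree)
open Summit.QuantumAdvantage.QuantumAdvantage.Theorems.CounterDial (CounterForm StabCounter)
open Summit.QuantumAdvantage.QuantumAdvantage.Theorems.AbelianDial (alin TableForm StabTable AbelianLoss3
  NonAbelianLoss3 tableForm_of_counterForm stabTable_of_stabCounter nT pcell qcell pcell_injective qcell_injective
  pcell_ne_qcell qG qG_apply qStrat qStrat_agree qStrat_mem6 mem_dev_q_second indB oddZeros_indB)
open Summit.QuantumAdvantage.QuantumAdvantage.Theorems.AbelianDial (q_in_dense_class q_not_tableForm_zero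
  q_not_counterForm_zero)
open Summit.QuantumAdvantage.QuantumAdvantage.Theorems.ShadowDial (aL aW aW_pos two_mul_le_two_pow aW_mul_eight aL_lt
  aL_add_three_le acell enc dcell acell_val dcell_val acell_injective dcell_injective acell_ne_dcell dcell_ne_zero
  dcell_lt_last muxStrat muxStrat_agree muxStrat_mem_logpow mem_dev_mux_second shadow shadow_pad_zero
  q_shadow_degree_linear)
open Summit.QuantumAdvantage.QuantumAdvantage.Theorems.ScaleDial (logpow_add_logpow_le)

variable {N : ℕ}

/-! ## §1  THE DIAL: bounded polynomial-phase table form `(m, r, d)` (special) versus not (generic residual) -/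

/-- the POLYNOMIAL-PHASE READOUT of type `(m, r, d)`: `r` polynomial phases of degree `≤ d` in the input bits, read
modulo `m+1`, with coefficient table `w` on `d`-tuples of cells:
`x ↦ (Σ_τ w_{τ,j} · Π_{s<d} x_{τ s})_{j<r} ∈ (Z_{m+1})^r` (a `d`-tuple with repeated cells is a monomial of degree `< d`;
degree `d = 1` is the ABELIAN readout `alin` of NODE «AbelianDial», `aphase_one`). -/
def aphase (m r d : ℕ) (w : (Fin d → Fin N) → Fin r → ZMod (m + 1)) (x : Fin N → Bool) : Fin r → ZMod (m + 1) :=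
  fun j => ∑ τ : Fin d → Fin N, if (∀ s, x (τ s) = true) then w τ j else 0

/-- PHASE FORM `(m, r, d)`: at every odd input, position `k` deviates from the canonical guess iff the Boolean table `G k`
accepts the polynomial-phase readout `aphase m r d (w k)` — every deviation gate FACTORS THROUGH `r` POLYNOMIAL PHASES OF
DEGREE `≤ d` over `Z_{m+1}` (= is computed by a program over a nilpotent group of class `≤ d` and bounded exponent, in the
Barrington–Straubing–Thérien dictionary).  Degree `1` = table form (`phaseForm_of_tableForm`). -/
def PhaseForm (m r d : ℕ) (w : Fin N → (Fin d → Fin N) → Fin r → ZMod (m + 1))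
    (G : Fin N → (Fin r → ZMod (m + 1)) → Bool) (Q : Fin N → CubeFn (ZMod 3) N) : Prop :=
  ∀ x : Fin N → Bool, OddZeros x → ∀ k : Fin N, k ∈ dev Q x ↔ G k (aphase m r d (w k) x) = true

/-- CHEAPLY `(m, r, d)`-PHASE-FORM: after padding by stabilizer rows selected by polynomials of degree `≤ (log N)^e` (the
gauge format of `StabFew` / `StabCounter` / `StabTable`) the deviation field is in phase form `(m, r, d)`. Gauge-saturated
(§2). -/
def StabPhase (m r d e : ℕ) (P : Fin N → CubeFn (ZMod 3) N) : Prop :=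
  ∃ s : Fin N → CubeFn (ZMod 3) N, (∀ i, s i ∈ lowDeg (ZMod 3) N ((Nat.log 2 N) ^ e)) ∧
    ∃ (w : Fin N → (Fin d → Fin N) → Fin r → ZMod (m + 1)) (G : Fin N → (Fin r → ZMod (m + 1)) → Bool),
      PhaseForm m r d w G (pad P s)

/-- **S_φ — the SPECIAL piece `PhaseLoss3`**: for EVERY bounded phase type `(m, r, d)` there is an abelian type `(M, R)`
and exponents `a, C` such that: dense, not cheaply counter-form, not cheaply `(M, R)`-table-form but cheaply
`(m, r, d)`-phase-form low-degree strategies lose a polynomial fraction of the odd class. -/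
def PhaseLoss3 : Prop :=
  ∀ m r d : ℕ, ∃ M R : ℕ, ∃ a : ℕ, ∃ C : ℕ, ∀ c : ℕ, ∃ n₀ : ℕ, ∀ n ≥ n₀, ∀ P : Fin n → CubeFn (ZMod 3) n,
    (∀ i, P i ∈ lowDeg (ZMod 3) n ((Nat.log 2 n) ^ c)) →
      ¬ StabFew ((Nat.log 2 n) ^ a) 0 (c + 1) P → ¬ StabCounter (c + 1) P → ¬ StabTable M R (c + 1) P →
        StabPhase m r d (c + 1) P →
          ((univ.filter fun x : Fin n → Bool =>
              OddZeros x ∧ Rel x (fun i => decide (P i x = 1))).card : ℝ)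
            ≤ (1 - 1 / (n : ℝ) ^ C) * (2 : ℝ) ^ (n - 1)

/-- **G_φ — the GENERIC piece (RESIDUAL, gen 3) `NonPhaseLoss3`**: for SOME bounded phase type `(m, r, d)` and exponents
`a, C`: dense, not cheaply counter-form and NOT cheaply `(m, r, d)`-phase-form low-degree strategies lose a polynomial
fraction (the abelian hypothesis `¬ StabTable m r` of the target is the case `d = 1`, `nonPhase_of_G`). -/
def NonPhaseLoss3 : Prop :=
  ∃ m r d : ℕ, ∃ a : ℕ, ∃ C : ℕ, ∀ c : ℕ, ∃ n₀ : ℕ, ∀ n ≥ n₀, ∀ P : Fin n → CubeFn (ZMod 3) n,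
    (∀ i, P i ∈ lowDeg (ZMod 3) n ((Nat.log 2 n) ^ c)) →
      ¬ StabFew ((Nat.log 2 n) ^ a) 0 (c + 1) P → ¬ StabCounter (c + 1) P → ¬ StabPhase m r d (c + 1) P →
        ((univ.filter fun x : Fin n → Bool =>
            OddZeros x ∧ Rel x (fun i => decide (P i x = 1))).card : ℝ)
          ≤ (1 - 1 / (n : ℝ) ^ C) * (2 : ℝ) ^ (n - 1)

/-! ### degree one = the abelian dial -/

/-- the degree-`1` phase readout with coefficients `w τ := v (τ 0)` IS the abelian readout `alin m r v`. -/
theorem aphase_one (m r : ℕ) (v : Fin N → Fin r → ZMod (m + 1)) (x : Fin N → Bool) :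
    aphase m r 1 (fun τ => v (τ 0)) x = alin m r v x := by
  funext j
  unfold aphase alin
  exact Fintype.sum_equiv (Equiv.funUnique (Fin 1) (Fin N)) _ _ (fun τ => by
    simp only [Fin.forall_fin_one, Equiv.funUnique_apply, Fin.default_eq_zero])

/-- table form `(m, r)` is phase form `(m, r, 1)`. -/
theorem phaseForm_of_tableForm {m r : ℕ} {v : Fin N → Fin N → Fin r → ZMod (m + 1)}
    {G : Fin N → (Fin r → ZMod (m + 1)) → Bool} {Q : Fin N → CubeFn (ZMod 3) N} (h : TableForm m r v G Q) :
    PhaseForm m r 1 (fun k τ => v k (τ 0)) G Q := fun x hx k => by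
  rw [h x hx k, aphase_one]

/-- cheaply `(m, r)`-table-form ⟹ cheaply `(m, r, 1)`-phase-form (same gauge): the phase dial EXTENDS the abelian dial. -/
theorem stabPhase_of_stabTable {m r e : ℕ} {P : Fin N → CubeFn (ZMod 3) N} (h : StabTable m r e P) :
    StabPhase m r 1 e P := by
  obtain ⟨s, hs, v, G, hT⟩ := h
  exact ⟨s, hs, _, _, phaseForm_of_tableForm hT⟩

/-- cheaply counter-form ⟹ cheaply `(2, 1, 1)`-phase-form (counter form = abelian type `(2,1)`, NODE «AbelianDial» §2). -/
theorem stabPhase_of_stabCounter {e : ℕ} {P : Fin N → CubeFn (ZMod 3) N} (h : StabCounter e P) :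
    StabPhase 2 1 1 e P :=
  stabPhase_of_stabTable (stabTable_of_stabCounter h)

/-! ## §2  THE NODE: `closes` BY NAME onto the residual of record, N-tests, exactness, saturation -/

/-- **`closes` — THE NODE'S DECIDING THEOREM, onto the residual `Theorems.AbelianDial.NonAbelianLoss3` BY NAME**:
`PhaseLoss3 → NonPhaseLoss3 → NonAbelianLoss3`.  Take the generic witness type `(m, r, d)` with its `(a₂, C₂)`, instantiate
the special piece there to get `(M, R, a₁, C₁)`; the target's abelian type is `(M, R)`, `a, C, n₀ := max`; split the
target's class by `StabPhase m r d (c+1) P`. -/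
theorem closes (hS : PhaseLoss3) (hG : NonPhaseLoss3) : NonAbelianLoss3 := by
  obtain ⟨m, r, d, a₂, C₂, h₂⟩ := hG
  obtain ⟨M, R, a₁, C₁, h₁⟩ := hS m r d
  refine ⟨M, R, max a₁ a₂, max C₁ C₂, fun c => ?_⟩
  obtain ⟨n₁, hn₁⟩ := h₁ c
  obtain ⟨n₂, hn₂⟩ := h₂ c
  refine ⟨max (max n₁ n₂) 2, fun n hn P hP hgen hnc hnt => ?_⟩
  have hn2 : 2 ≤ n := le_trans (le_max_right _ _) hn
  have hn12 : max n₁ n₂ ≤ n := le_trans (le_max_left _ _) hn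
  have hL : 1 ≤ Nat.log 2 n := Nat.le_log_of_pow_le (by norm_num) (by simpa using hn2)
  have hg₁ : ¬ StabFew ((Nat.log 2 n) ^ a₁) 0 (c + 1) P := fun h =>
    hgen (stabFew_mono_mr (Nat.pow_le_pow_right hL (le_max_left _ _)) (one_le_logpow hn2 a₁) le_rfl h)
  have hg₂ : ¬ StabFew ((Nat.log 2 n) ^ a₂) 0 (c + 1) P := fun h =>
    hgen (stabFew_mono_mr (Nat.pow_le_pow_right hL (le_max_right _ _)) (one_le_logpow hn2 a₂) le_rfl h)
  by_cases ht : StabPhase m r d (c + 1) P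
  · exact loss_shape_mono (by omega) (le_max_left _ _) _ _ (by positivity)
      (hn₁ n (le_trans (le_max_left _ _) hn12) P hP hg₁ hnc hnt ht)
  · exact loss_shape_mono (by omega) (le_max_right _ _) _ _ (by positivity)
      (hn₂ n (le_trans (le_max_right _ _) hn12) P hP hg₂ hnc ht)

/-- the node composed with NODE «AbelianDial»'s `closes`: onto item B = `Theses.SparsityDial.NonCounterGenericLoss3`
(stmt-QuantumAdvantage-27009) — `AbelianLoss3 → PhaseLoss3 → NonPhaseLoss3 → B`. -/
theorem closesB (hAb : AbelianLoss3) (hS : PhaseLoss3) (hG : NonPhaseLoss3) :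
    Summit.QuantumAdvantage.QuantumAdvantage.Theses.SparsityDial.NonCounterGenericLoss3 :=
  Summit.QuantumAdvantage.QuantumAdvantage.Theorems.AbelianDial.closes hAb (closes hS hG)

/-- … and with the sibling A = `Theses.SparsityDial.CounterLoss3` (27008) onto the parent D =
`Theses.SparsityDial.DenseGenericLoss3` (27656): `A → AbelianLoss3 → PhaseLoss3 → NonPhaseLoss3 → D`. -/
theorem closesD (hA : Summit.QuantumAdvantage.QuantumAdvantage.Theses.SparsityDial.CounterLoss3) (hAb : AbelianLoss3)
    (hS : PhaseLoss3) (hG : NonPhaseLoss3) : Summit.QuantumAdvantage.QuantumAdvantage.Theses.SparsityDial.DenseGenericLoss3 :=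
  Summit.QuantumAdvantage.QuantumAdvantage.Theorems.AbelianDial.closesD hA hAb (closes hS hG)

/-- N-test, special piece: `NonAbelianLoss3 → PhaseLoss3` (restriction: ignore the phase-form hypothesis; `(M, R)` := the
target's own abelian type). -/
theorem phase_of_G (hG : NonAbelianLoss3) : PhaseLoss3 := by
  obtain ⟨m₀, r₀, a, C, h⟩ := hG
  refine fun m r d => ⟨m₀, r₀, a, C, fun c => ?_⟩
  obtain ⟨n₀, hn₀⟩ := h c
  exact ⟨n₀, fun n hn P hP hgen hnc hnt _ => hn₀ n hn P hP hgen hnc hnt⟩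

/-- N-test, generic piece: `NonAbelianLoss3 → NonPhaseLoss3` (at `d = 1` and the target's abelian type: not cheaply
`(m, r, 1)`-phase-form ⟹ not cheaply `(m, r)`-table-form, `stabPhase_of_stabTable`). -/
theorem nonPhase_of_G (hG : NonAbelianLoss3) : NonPhaseLoss3 := by
  obtain ⟨m₀, r₀, a, C, h⟩ := hG
  refine ⟨m₀, r₀, 1, a, C, fun c => ?_⟩
  obtain ⟨n₀, hn₀⟩ := h c
  exact ⟨n₀, fun n hn P hP hgen hnc hnp => hn₀ n hn P hP hgen hnc (fun ht => hnp (stabPhase_of_stabTable ht))⟩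

/-- EXACTNESS of the split: `NonAbelianLoss3 ↔ PhaseLoss3 ∧ NonPhaseLoss3` (no strength lost at the junction). -/
theorem split_iff : NonAbelianLoss3 ↔ (PhaseLoss3 ∧ NonPhaseLoss3) :=
  ⟨fun h => ⟨phase_of_G h, nonPhase_of_G h⟩, fun h => closes h.1 h.2⟩

/-- the residual chain after this node: item B ↔ `AbelianLoss3 ∧ PhaseLoss3 ∧ NonPhaseLoss3` (with NODE «AbelianDial»'s
`split_iff`). -/
theorem splitB_iff : Summit.QuantumAdvantage.QuantumAdvantage.Theses.SparsityDial.NonCounterGenericLoss3 ↔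
    (AbelianLoss3 ∧ PhaseLoss3 ∧ NonPhaseLoss3) := by
  rw [Summit.QuantumAdvantage.QuantumAdvantage.Theorems.AbelianDial.split_iff, split_iff]

/-- the node ALSO splits NODE «ShadowDial»'s residual `TernaryLoss3` (which is `↔ NonAbelianLoss3`, its `residual_iff`):
the phase dial is orthogonal to the shadow dial (`qStrat` ∈ shadow-residual ∩ phase-special, `muxStrat` ∈ shadow-special ∩
phase-residual, §§3–5). -/
theorem splitT_iff : Summit.QuantumAdvantage.QuantumAdvantage.Theorems.ShadowDial.TernaryLoss3 ↔
    (PhaseLoss3 ∧ NonPhaseLoss3) := by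
  rw [Summit.QuantumAdvantage.QuantumAdvantage.Theorems.ShadowDial.residual_iff, split_iff]

/-! ### saturation under the gauge (the row-padding test), as for `StabTable` -/

/-- ROW-PADDING TEST, direction 1: a strategy one of whose cheap pads is cheaply phase-form is itself cheaply phase-form
(one notch up). -/
theorem stabPhase_of_stabPhase_pad (hN : 16 ≤ N) {m r d e₀ e : ℕ} (he : e₀ ≤ e) {P s₀ : Fin N → CubeFn (ZMod 3) N}
    (hs₀ : ∀ i, s₀ i ∈ lowDeg (ZMod 3) N ((Nat.log 2 N) ^ e₀)) (h : StabPhase m r d e (pad P s₀)) :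
    StabPhase m r d (e + 1) P := by
  obtain ⟨s, hs, w, G, hF⟩ := h
  refine ⟨gsum s₀ s, fun i => lowDeg_mono (deg_gsum hN he) (gsum_mem hs₀ hs i), w, G, fun x hx k => ?_⟩
  rw [← dev_congr (fun x => outB_pad_pad P s₀ s x) x]
  exact hF x hx k

/-- ROW-PADDING TEST, direction 2: padding a cheaply phase-form strategy keeps it cheaply phase-form. -/
theorem stabPhase_pad_of_stabPhase (hN : 16 ≤ N) {m r d e₀ e : ℕ} (he : e₀ ≤ e) {P s₀ : Fin N → CubeFn (ZMod 3) N}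
    (hs₀ : ∀ i, s₀ i ∈ lowDeg (ZMod 3) N ((Nat.log 2 N) ^ e₀)) (h : StabPhase m r d e P) :
    StabPhase m r d (e + 1) (pad P s₀) := by
  obtain ⟨s, hs, w, G, hF⟩ := h
  refine ⟨gsum s₀ s, fun i => lowDeg_mono (deg_gsum hN he) (gsum_mem hs₀ hs i), w, G, fun x hx k => ?_⟩
  have e1 : ∀ x, outB (pad (pad P s₀) (gsum s₀ s)) x = outB (pad P s) x := fun x => by
    rw [outB_pad_pad]
    exact outB_pad_congr (fun i x => by
      rw [bitP_gsum, bitP_gsum, ← Bool.xor_assoc, Bool.xor_self, Bool.false_xor]) P x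
  rw [dev_congr e1 x]
  exact hF x hx k

/-- membership of a position in the deviation set depends on the strategy only through that position's polynomial. -/
theorem mem_dev_congr_at {P Q : Fin N → CubeFn (ZMod 3) N} {k : Fin N} (h : P k = Q k) (x : Fin N → Bool) :
    k ∈ dev P x ↔ k ∈ dev Q x := by
  simp only [Summit.QuantumAdvantage.QuantumAdvantage.Theorems.AnchorDial.dev, mem_filter, mem_univ, true_and, h]

end Summit.QuantumAdvantage.QuantumAdvantage.Theorems.PhaseDial
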